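import Mathlib
import HarnessLib
import Summits.HubbardSuperconductivity.HubbardSuperconductivity.Theorems.KLProgrammeKLRegimeVolumeLimitTwoPointTimeC2
import Summits.HubbardSuperconductivity.HubbardSuperconductivity.Theorems.KLProgrammeKLRegimeVolumeLimitTwoPointBareBound

/-!
# Child `KLRegimeVolumeLimitV14` (stmt-HubbardSuperconductivity-19921): the registered stub `stub_vl_bound` of the «cauchy» skeleton, CLOSED
# (seat hubbard-kl-k3c4-p2, g3; «Matsubara all-U route (R-a)»)

`stub_vl_bound` (skeleton f5b495cbb8e8ff52, k3c4-p1; namespace `…Theorems.KLRegimeVolumeLimit`, `klPredsV14` text) is k3c5-p2's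
`stub_vl_bound_V14_of_H1` (p490789: (H1) ⟹ bare-frame uniform bound ⟹ the registered text through k3c4-p1's V14 door) applied to the
now-unconditional (H1) `MatsubaraAllU.twoPoint_H1` (`…VolumeLimitTwoPointTimeC2`: p484918 two-time Dyson series + p490677 split-pair determinant
(k3c5-p1) + the Grassmann-side reduction/wrapper/dictionary/match and the determinant identity (this seat) + k3c5-p2's all-`U` Matsubara limit).
Everything is proved; no definition.
-/

noncomputable section

namespace Summit.HubbardSuperconductivity.HubbardSuperconductivity.Theorems.KLRegimeVolumeLimit

set_option linter.dupNamespace false -- summit = problem name (single-conjunct summit), D-0017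

open Filter Topology Literature.MathematicalPhysics.QuantumLattice Literature.Probability.LatticeModels
open Literature.MathematicalPhysics.QuantumLattice.FermiRG
open Summit.HubbardSuperconductivity.HubbardSuperconductivity.Theorems.ThermalGreen
open Summit.HubbardSuperconductivity.HubbardSuperconductivity.Theorems.TwoPointAssembly
open Summit.HubbardSuperconductivity.HubbardSuperconductivity.Theorems.KLRegimeSplit
open Summit.HubbardSuperconductivity.HubbardSuperconductivity.Theorems.KLProgrammeLegKernels

/-- **Registered stub `stub_vl_bound` of the VL child `KLRegimeVolumeLimitV14`** (text verbatim): in the KL regime, for every admissible frame and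
tower, the last-slice self-energy `klSelfEnergy L M β U μ K klE0 (nScales β + 1) k σ` is bounded uniformly in `L ≥ L₀`, `M ≥ Mth L`, `k`, `σ`.
Proof: `TwoPointAssembly.stub_vl_bound_V14_of_H1 MatsubaraAllU.twoPoint_H1`. -/
theorem stub_vl_bound :
    ∀ (G : GeoConsts) (P : SplitConsts) (Q : EngConsts) (R : RenConsts), G.WF → P.WF → Q.WF → R.WF →
      ∃ c₅ : ℝ, 0 < c₅ ∧ ∀ c : ℝ, 0 < c → c ≤ c₅ → ∃ U₀ : ℝ, 0 < U₀ ∧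
        ∀ μ ∈ klWindowC, ∀ U : ℝ, 0 < U → U ≤ U₀ → ∀ β : ℝ, klBetaMin ≤ β → β ≤ Real.exp (c / U ^ 2) →
          ∀ K : TrigPolyC4v, klPredsV14.frameOK R U (nScales β) μ K →
            ∀ (Lstar : ℕ) (Mstar : ℕ → ℕ), TowerP klPredsV14 G P Q R β U μ K Lstar Mstar →
              ∃ B : ℝ, ∃ L₀ : ℕ, ∃ Mth : ℕ → ℕ, ∀ (L : ℕ) [NeZero L], L₀ ≤ L → ∀ (M : ℕ) [NeZero M], Mth L ≤ M →
                ∀ (k : FreqMomentum L M) (σ : Fin 2), ‖klSelfEnergy L M β U μ K klE0 (nScales β + 1) k σ‖ ≤ B :=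
  TwoPointAssembly.stub_vl_bound_V14_of_H1 MatsubaraAllU.twoPoint_H1

end Summit.HubbardSuperconductivity.HubbardSuperconductivity.Theorems.KLRegimeVolumeLimit

end
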